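import Summits.NavierStokesRegularity.NavierStokesRegularity.Theses.CoriolisHead
import Summits.NavierStokesRegularity.NavierStokesRegularity.Theorems.CoriolisHeadCounterRotatingLiouvilleHeadIdentity
import Summits.NavierStokesRegularity.NavierStokesRegularity.Theorems.CoriolisHeadCounterRotatingLiouvilleHeadGrowth
import Summits.NavierStokesRegularity.NavierStokesRegularity.Theorems.CoriolisHeadCounterRotatingLiouvilleSkewLiouville
import Summits.NavierStokesRegularity.NavierStokesRegularity.Theorems.CoriolisHeadCounterRotatingLiouvilleEndgame

/-!
# Route CoriolisHead — crux `CounterRotatingLiouville` (stmt-NavierStokesRegularity-22677): PROVED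

**Theorem.** Let `ν, a > 0`, `B : ℝ³ →L ℝ³` skew (`⟪Bx, x⟫ = 0`), `U ∈ C^∞(ℝ³; ℝ³)` bounded,
`P ∈ C²`, `div U = 0`, and let the rotated Leray profile system
`−νΔU + aU + a(y·∇)U + (BU − (By·∇)U) + (U·∇)U + ∇P = 0` hold pointwise (Pineau–Vicol's (1.8)
with the rotation generator `αJ` replaced by a general skew `B`; `B = 0` is Leray's system).  If the
Coriolis defect is signed, `Σₗ (B ∂ₗU)ₗ = tr(B∘DU) ≥ 0` everywhere (the vorticity never co-rotates
with the frame), then `U` is constant.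

This is Tsai's 1998 Theorem 1 at `q = ∞` (the tree's `IsLerayProfile.exists_eq_const_of_bounded`)
extended to EVERY rotation rate on the counter-rotating class, via the rotating head pressure
`Π_B = ½|U|² + P + a⟨y,U⟩ − ⟨By,U⟩`.  Proof = the registered skeleton of the line
`tsai-rotating-head-chain` with its four stubs, all landed:

1. `CoriolisHead.stub_rotatingHeadIdentity` — the exact identity
   `νΔΠ_B − (U − By + ay)·∇Π_B = ½ν Σ (∂ₗUᵢ − ∂ᵢUₗ)² + 2ν Σₗ (B ∂ₗU)ₗ`, so `Π_B` is an
   `L`-subsolution under the sign hypothesis;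
2. `CoriolisHead.stub_rssHeadGrowth` — `|Π_B(y)| ≤ C(1 + |y|)^N` (port of Tsai's Lemma 3.2 chain
   to the rotated system: local pressure control, Lemma 3.1, one Stokes–Sobolev round, oscillation);
3. `CoriolisHead.stub_skewLiouville51` — Tsai's Lemma 5.1 for the skew drift `U − By + ay` with
   `‖B‖` arbitrary (the skew part is invisible on centred Gaussian barriers), so `Π_B` is constant;
4. `CoriolisHead.stub_endgame` — then `curl U = 0`, and with `div U = 0`, `U` bounded, `U` is
   constant.

NS regularity is NOT proved by this: the route's assembly still needs the open cruxes/residuals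
`NoCoRotatingCore` (stmt-22676), `ExtremalSpiralSymmetry` (stmt-8215) and `NoTypeII` (stmt-0056).
-/

noncomputable section

-- the summit and its single sub-problem share the name (CONVENTIONS §1), as in every Theorems file
set_option linter.dupNamespace false

open scoped BigOperators RealInnerProductSpace
open Literature.Analysis.FluidPDE

namespace Summit.NavierStokesRegularity.NavierStokesRegularity.Theorems

/-- **Crux `CounterRotatingLiouville` of route CoriolisHead** (stmt-NavierStokesRegularity-22677):
a smooth bounded rotated Leray profile (`ν, a > 0`, skew `B` of any size) whose Coriolis defect
`tr(B∘DU)` is `≥ 0` everywhere is constant.  Composition of the four landed stubs of the line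
`tsai-rotating-head-chain` (identity ⇒ subsolution, growth, skew Lemma 5.1 ⇒ constant head,
endgame). -/
theorem counterRotatingLiouville_proof :
    Summit.NavierStokesRegularity.NavierStokesRegularity.Theses.CoriolisHead.CounterRotatingLiouville := by
  intro ν a hν ha B U P hU hP hB hdiv heq hbdd hsign
  -- the rotating head is a subsolution: identity + sign hypothesis
  have hsub : ∀ y, 0 ≤ driftOp ν a (fun z => U z - B z)
      (fun z => headPressure a U P z - ⟪B z, U z⟫) y := by
    intro y
    rw [CoriolisHead.stub_rotatingHeadIdentity ν a B U P hU hP hB hdiv heq y]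
    have h1 : 0 ≤ ∑ l, ∑ i, (pderiv l (fun z => U z i) y - pderiv i (fun z => U z l) y) ^ 2 :=
      Finset.sum_nonneg fun l _ => Finset.sum_nonneg fun i _ => sq_nonneg _
    have h2 := hsign y
    positivity
  have hgrowth := CoriolisHead.stub_rssHeadGrowth ν a hν ha B U P hU hP hB hdiv heq hbdd
  have hconst := CoriolisHead.stub_skewLiouville51 ν a hν ha B U P hU hP hB hdiv heq hbdd hsub hgrowth
  exact CoriolisHead.stub_endgame ν a hν ha B U P hU hP hB hdiv heq hbdd hsign hconst

/-- The registered skeleton's composing theorem, by name: the crux from its four stubs. -/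
theorem CounterRotatingLiouville_of :
    Summit.NavierStokesRegularity.NavierStokesRegularity.Theses.CoriolisHead.CounterRotatingLiouville :=
  counterRotatingLiouville_proof

end Summit.NavierStokesRegularity.NavierStokesRegularity.Theorems

end
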